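import Summits.AtomisticToContinuum.HydrodynamicLimit.Theses.ImplosionDichotomy

/-!
# Line `conformal-clock` — crux `ImplosionDichotomy.PolynomialCompression` (stmt-AtomisticToContinuum-12587)

Skeleton (crux-plan, round 1). Idea card `conformal-clock` (ideator 2): the monatomic gas (`e = 3θ/2`,
`p = ρθ`, `γ = 5/3 = 1 + 2/d`) is covariant under the projective ("Schrödinger", "pseudo-conformal")
map `t = a s/(a+s)`, `x = (a/(a+s)) y`, `ρ = λ⁻³ ρ̂`, `θ = λ⁻² θ̂`, `u = λ⁻¹ û − y/a`, `λ = a/(a+s)`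
(Serre 1997, Prop. 2.1): the CONFORMAL CLOCK `s = a t/(a−t) ∈ [0, ∞)` sends the self-similar implosion at
`T* = a` to a GLOBAL expanding flow whose gradients decay like `1/(a+s)` (Type I read in the dual clock),
and it sends the hard-sphere law `p = ρθZ(ρσ³)` to a gas of linearly GROWING diameter `σ(a+s)/a` heated at
the rate `2θ(Z−1)/(a+s)` (packing `η = ρσ³` is a projective invariant). Tracking the σ-solution against
the σ = 0 implosion is then a long-time estimate with `(a+s)⁻¹` coefficients: the loss is a POWER of the
conformal factor `Λ = (a+s)/a = T*/(T*−t)`, the σ-solution shadows the collapse down to conformal depth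
`T* − T ≍ σ^e`, and the core density `c (T*−t)^{−β}` read at that depth gives `κ = eβ/2`.

Stubs (sorried, registered): `stub_clockedIdealImplosion` (σ = 0 reference in conformal normal form),
`stub_smoothStatics` (LLN-tied data family, `O(σ³)` in every `C^m`), `stub_projectiveCovariance` (the exact
clock identity with the hard-sphere anomaly), `stub_conformalClockShadowing` (the load-bearing estimate).
Composition (sorry-free): `polynomialCompression_of_parts`, `PolynomialCompression_of`.
-/

noncomputable section

open MeasureTheory Set Filter Topology

namespace Summit.AtomisticToContinuum.HydrodynamicLimit.Cruxes.PolynomialCompression.ConformalClock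

open Literature.MathematicalPhysics.KineticTheory (T3 V3 IsHardSphereEulerSolution hsDiameter localGibbsLaw
  TendstoHydroFieldsAt)
open Summit.AtomisticToContinuum.HydrodynamicLimit.Theses.ImplosionDichotomy (PolynomialCompression)

/-! ## The σ = 0 reference in conformal normal form -/

/-- **Conformal normal form** of an ideal-gas (`σ = 0`) classical solution on `[0, T*) × 𝕋³` imploding at
`T*`: implosion rate `β` of the core density in the conformal factor `T* − t` (`= a λ`), Type-I first
derivatives (`≤ C/(T*−t)`, i.e. dual-clock gradients `≤ C'/(a+s)`), two-sided polynomial bounds and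
polynomial bounds in `T* − t` for the spatial derivatives of order `≤ 8` (enough for an `H^6` energy
method on the difference; CGSS control `K ≫ 8` derivatives uniformly in self-similar time). -/
def InConformalNormalForm (Ts β c : ℝ) (ρ₁ θ₁ : ℝ → T3 → ℝ) (u₁ : ℝ → T3 → V3) : Prop :=
  0 < Ts ∧ 0 < β ∧ 0 < c ∧ IsHardSphereEulerSolution 0 Ts ρ₁ u₁ θ₁ ∧
  (∀ t ∈ Set.Ico 0 Ts, ∃ x, c * (Ts - t) ^ (-β) ≤ ρ₁ t x) ∧
  (∃ C : ℝ, ∀ t ∈ Set.Ico 0 Ts, ∀ x, ∀ i : Fin 3,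
      ‖Literature.Analysis.FunctionSpaces.Torus.partialDeriv i (u₁ t) x‖ ≤ C / (Ts - t) ∧
      |Literature.Analysis.FunctionSpaces.Torus.partialDeriv i (fun y => Real.sqrt (θ₁ t y)) x| ≤ C / (Ts - t) ∧
      |Literature.Analysis.FunctionSpaces.Torus.partialDeriv i (fun y => Real.log (ρ₁ t y)) x| ≤ C / (Ts - t) ∧
      |Literature.Analysis.FunctionSpaces.Torus.partialDeriv i (fun y => Real.log (θ₁ t y)) x| ≤ C / (Ts - t)) ∧
  (∃ C q : ℝ, 0 < C ∧ ∀ t ∈ Set.Ico 0 Ts, ∀ x,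
      (Ts - t) ^ q / C ≤ ρ₁ t x ∧ ρ₁ t x ≤ C * (Ts - t) ^ (-q) ∧
      (Ts - t) ^ q / C ≤ θ₁ t x ∧ θ₁ t x ≤ C * (Ts - t) ^ (-q) ∧ ‖u₁ t x‖ ≤ C * (Ts - t) ^ (-q)) ∧
  (∀ m : ℕ, m ≤ 8 → ∃ C q : ℝ, ∀ t ∈ Set.Ico 0 Ts, ∀ y,
      ‖iteratedFDeriv ℝ m (Literature.Analysis.FunctionSpaces.Torus.lift (ρ₁ t)) y‖ ≤ C * (Ts - t) ^ (-q) ∧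
      ‖iteratedFDeriv ℝ m (Literature.Analysis.FunctionSpaces.Torus.lift (θ₁ t)) y‖ ≤ C * (Ts - t) ^ (-q) ∧
      ‖iteratedFDeriv ℝ m (Literature.Analysis.FunctionSpaces.Torus.lift (u₁ t)) y‖ ≤ C * (Ts - t) ^ (-q))

/-- Statement of `stub_clockedIdealImplosion`: a monatomic ideal-gas implosion on `𝕋³` from continuous
positive profiles, with PINNED data `(a₀/∫a₀, u₀, θ₀)`, in conformal normal form. -/
def ClockedIdealImplosion : Prop :=
  ∃ (a₀ θ₀ : T3 → ℝ) (u₀ : T3 → V3), Continuous a₀ ∧ Continuous θ₀ ∧ Continuous u₀ ∧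
    (∀ x, 0 < a₀ x) ∧ (∀ x, 0 < θ₀ x) ∧
    ∃ (Ts β c : ℝ) (ρ₁ θ₁ : ℝ → T3 → ℝ) (u₁ : ℝ → T3 → V3),
      InConformalNormalForm Ts β c ρ₁ θ₁ u₁ ∧ (∀ x, ρ₁ 0 x = a₀ x / ∫ y, a₀ y) ∧ u₁ 0 = u₀ ∧ θ₁ 0 = θ₀

/-! ## The LLN-tied data family -/

/-- Statement of `stub_smoothStatics`: for continuous positive profiles with SMOOTH normalised activity
`b = a₀/∫a₀` there is, for all small `σ`, a smooth positive density `ρ₀^σ` (the limit density `rhoLim` of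
the canonical hard-sphere gas) with `‖ρ₀^σ − b‖_{C^m} ≤ A_m σ³` for every `m`, such that the local Gibbs
laws are probability measures and their `t = 0` empirical fields satisfy the law of large numbers towards
`(ρ₀^σ, u₀, θ₀)` for every family of hard-sphere flows (the admissibility tie of the crux). -/
def SmoothStatics : Prop :=
  ∀ (a₀ θ₀ : T3 → ℝ) (u₀ : T3 → V3), Continuous a₀ → Continuous θ₀ → Continuous u₀ →
    (∀ x, 0 < a₀ x) → (∀ x, 0 < θ₀ x) →
    Literature.Analysis.FunctionSpaces.Torus.IsSmooth (fun x => a₀ x / ∫ y, a₀ y) →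
    ∃ σ₁ : ℝ, 0 < σ₁ ∧ ∃ ρ₀ : ℝ → T3 → ℝ,
      (∀ m : ℕ, ∃ A : ℝ, ∀ σ : ℝ, 0 < σ → σ < σ₁ → ∀ y,
        ‖iteratedFDeriv ℝ m (Literature.Analysis.FunctionSpaces.Torus.lift (ρ₀ σ) -
            Literature.Analysis.FunctionSpaces.Torus.lift (fun x => a₀ x / ∫ y, a₀ y)) y‖ ≤ A * σ ^ 3) ∧
      (∀ σ : ℝ, 0 < σ → σ < σ₁ →
        Literature.Analysis.FunctionSpaces.Torus.IsSmooth (ρ₀ σ) ∧ (∀ x, 0 < ρ₀ σ x) ∧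
        ∀ Φ : (N : ℕ) → Literature.Analysis.FluidPDE.HardSphereFlow
            (Literature.Analysis.FluidPDE.Torus.geometry (Fin 3)) (hsDiameter σ N) (N + 1),
          (∀ N, IsProbabilityMeasure (localGibbsLaw σ a₀ u₀ θ₀ N (Φ N))) ∧
          TendstoHydroFieldsAt (fun N => localGibbsLaw σ a₀ u₀ θ₀ N (Φ N)) Φ
            (fun _ => ρ₀ σ) (fun _ => u₀) (fun _ => θ₀) 0)

/-! ## The conformal clock: projective covariance with the hard-sphere anomaly -/

/-- The projective (conformal-clock) point map with parameter `a`: dual `(s, y) ↦` physical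
`(t, x) = (a s/(a+s), (a/(a+s)) y)`. -/
def clockMap (a : ℝ) (z : ℝ × V3) : ℝ × V3 := (a * z.1 / (a + z.1), (a / (a + z.1)) • z.2)

/-- Dual density `ρ̂(s,y) = λ³ ρ(t,x)`, `λ = a/(a+s)`. -/
def dualDensity (a : ℝ) (P : ℝ × V3 → ℝ) (z : ℝ × V3) : ℝ := (a / (a + z.1)) ^ 3 * P (clockMap a z)

/-- Dual temperature `θ̂(s,y) = λ² θ(t,x)`. -/
def dualTemperature (a : ℝ) (Θ : ℝ × V3 → ℝ) (z : ℝ × V3) : ℝ := (a / (a + z.1)) ^ 2 * Θ (clockMap a z)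

/-- Dual velocity `û(s,y) = λ u(t,x) + y/(a+s)` (Hubble term of the expanding dual). -/
def dualVelocity (a : ℝ) (U : ℝ × V3 → V3) (z : ℝ × V3) : V3 :=
  (a / (a + z.1)) • U (clockMap a z) + (1 / (a + z.1)) • z.2

/-- `∂ₜ F (z)` on `ℝ × ℝ³`. -/
def dT {G : Type*} [NormedAddCommGroup G] [NormedSpace ℝ G] (F : ℝ × V3 → G) (z : ℝ × V3) : G :=
  fderiv ℝ F z ((1 : ℝ), (0 : V3))

/-- `∂ᵢ F (z)` on `ℝ × ℝ³`. -/
def dX {G : Type*} [NormedAddCommGroup G] [NormedSpace ℝ G] (i : Fin 3) (F : ℝ × V3 → G) (z : ℝ × V3) : G :=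
  fderiv ℝ F z ((0 : ℝ), EuclideanSpace.single i (1 : ℝ))

/-- The full Euler system of a monatomic gas (`e = 3θ/2`) with pressure law `p = ρ θ Z(ρ d(t)³)`
(diameter `d(t)`) and heating rate `h(t) θ (Z − 1)`, at the space-time point `z = (t, x) ∈ ℝ × ℝ³`, in
non-conservative form: mass, momentum (`ρ Du/Dt + ∇p = 0`), temperature
(`Dθ/Dt + (2/3) θ Z div u = h θ (Z−1)`). Physical hard spheres: `d ≡ σ`, `h ≡ 0`; conformal dual:
`d(s) = σ(a+s)/a`, `h(s) = 2/(a+s)`. -/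
def EulerZAt (d h : ℝ → ℝ) (Z : ℝ → ℝ) (P Θ : ℝ × V3 → ℝ) (U : ℝ × V3 → V3) (z : ℝ × V3) : Prop :=
  dT P z + ∑ i, dX i (fun w => P w * U w i) z = 0 ∧
  (∀ j : Fin 3, P z * (dT (fun w => U w j) z + ∑ i, U z i * dX i (fun w => U w j) z) +
      dX j (fun w => P w * Θ w * Z (P w * d w.1 ^ 3)) z = 0) ∧
  dT Θ z + ∑ i, U z i * dX i Θ z + (2 / 3) * Θ z * Z (P z * d z.1 ^ 3) * ∑ i, dX i (fun w => U w i) z =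
      h z.1 * Θ z * (Z (P z * d z.1 ^ 3) - 1)

/-- Statement of `stub_projectiveCovariance`: for every `C¹`-at-the-point triple and every equation of
state `Z` differentiable at the (projectively invariant) packing `η = ρσ³`, the physical system with
diameter `σ` and no heating holds at `(t,x) = clockMap a (s,y)` iff the dual system with growing diameter
`σ(a+s)/a` and heating rate `2/(a+s)` holds at `(s,y)` for the dual fields (`a > 0`, `s ≥ 0`). At `Z ≡ 1`
this is the projective symmetry of the monatomic gas (Serre 1997, Prop. 2.1). -/
def ProjectiveCovariance : Prop :=
  ∀ (a σ : ℝ), 0 < a → ∀ (Z : ℝ → ℝ) (P Θ : ℝ × V3 → ℝ) (U : ℝ × V3 → V3) (z : ℝ × V3), 0 ≤ z.1 →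
    DifferentiableAt ℝ P (clockMap a z) → DifferentiableAt ℝ Θ (clockMap a z) →
    DifferentiableAt ℝ U (clockMap a z) → DifferentiableAt ℝ Z (P (clockMap a z) * σ ^ 3) →
    (EulerZAt (fun _ => σ) (fun _ => 0) Z P Θ U (clockMap a z) ↔
      EulerZAt (fun s => σ * (a + s) / a) (fun s => 2 / (a + s)) Z
        (dualDensity a P) (dualTemperature a Θ) (dualVelocity a U) z)

/-! ## The load-bearing estimate: shadowing to conformal depth `σ^e` -/

/-- Statement of `stub_conformalClockShadowing`: given the clock identity, for every `σ = 0` reference in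
conformal normal form and every family of smooth positive data densities `σ³`-close to the reference datum
in every `C^m`, there are a loss exponent `K`, constants `A, B`, a depth exponent `e > 0` and `σ₂ > 0` such
that for `0 < σ < σ₂` a classical hard-sphere-Euler solution with data `(ρ₀^σ, u₁(0), θ₁(0))` exists down
to conformal depth `T* − T ≤ B σ^e` and its density stays within the relative error
`A σ³ (T*/(T*−t))^K` (a power of the conformal factor `Λ = (a+s)/a`) and within a factor `2` of the
reference density. -/
def ConformalClockShadowing : Prop :=
  ProjectiveCovariance →
  ∀ (Ts β c : ℝ) (ρ₁ θ₁ : ℝ → T3 → ℝ) (u₁ : ℝ → T3 → V3), InConformalNormalForm Ts β c ρ₁ θ₁ u₁ →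
  ∀ (σ₁ : ℝ) (ρ₀ : ℝ → T3 → ℝ), 0 < σ₁ →
    (∀ m : ℕ, ∃ A : ℝ, ∀ σ : ℝ, 0 < σ → σ < σ₁ → ∀ y,
      ‖iteratedFDeriv ℝ m (Literature.Analysis.FunctionSpaces.Torus.lift (ρ₀ σ) -
          Literature.Analysis.FunctionSpaces.Torus.lift (ρ₁ 0)) y‖ ≤ A * σ ^ 3) →
    (∀ σ : ℝ, 0 < σ → σ < σ₁ →
      Literature.Analysis.FunctionSpaces.Torus.IsSmooth (ρ₀ σ) ∧ ∀ x, 0 < ρ₀ σ x) →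
    ∃ (K : ℕ) (A B e σ₂ : ℝ), 0 < e ∧ 0 < B ∧ 0 < σ₂ ∧ σ₂ ≤ σ₁ ∧
      ∀ σ : ℝ, 0 < σ → σ < σ₂ →
        ∃ (T : ℝ) (ρ θ : ℝ → T3 → ℝ) (u : ℝ → T3 → V3),
          0 < T ∧ T < Ts ∧ Ts - T ≤ B * σ ^ e ∧
          IsHardSphereEulerSolution σ T ρ u θ ∧ ρ 0 = ρ₀ σ ∧ u 0 = u₁ 0 ∧ θ 0 = θ₁ 0 ∧
          ∀ t ∈ Set.Ico 0 T, ∀ x,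
            |ρ t x - ρ₁ t x| ≤ A * σ ^ 3 * (Ts / (Ts - t)) ^ K * ρ₁ t x ∧ ρ₁ t x ≤ 2 * ρ t x

/-! ## Registered stubs -/

/-- STUB 1 (size L with a vendored Type-I CGSS/BCG fact, XL without): the `γ = 5/3` implosion of
Cao-Labora–Gómez-Serrano–Shi–Staffilani (arXiv:2310.05325, Thm 1.2 + Rem 1.4–1.5; profiles of
Buckmaster–Cao-Labora–Gómez-Serrano arXiv:2208.09445 Thm 1.1) written as a full-system solution
(`θ := (3/5) ρ^{2/3}` up to constants, unit torus, unit mass) in conformal normal form: `β = 3(1 − 1/r)`,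
Type I from the self-similar scaling `∇ₓ = (T−t)^{−1/r}∇_y`, (1.6) and p. 26 l. 1. -/
theorem stub_clockedIdealImplosion : ClockedIdealImplosion := by
  sorry

/-- STUB 2 (size M–L): quantitative smooth low-density statics — `rhoLim` (tree) differentiated termwise
(`abs_clusterCoeff_le`, `|R − 1| = O(σ³)` from `ratioLimit_spec`), positivity (`rhoLim_pos`), probability
laws (`isProbabilityMeasure_localGibbsLaw`) and the PROVED LLN (`localGibbs_densityLLN_holds`,
`localGibbs_lln_of_densityLLN`) with the limit density exposed. Disproof.lean §6 input I2. -/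
theorem stub_smoothStatics : SmoothStatics := by
  sorry

/-- STUB 3 (size M): the conformal clock itself — projective covariance of the monatomic full Euler system
with a general equation of state `p = ρθZ(ρσ³)`: exact in mass and momentum with the growing diameter
`σ(a+s)/a`, with the temperature anomaly `2θ(Z−1)/(a+s)` (chain rule; Serre 1997 Prop. 2.1 at `Z ≡ 1`). -/
theorem stub_projectiveCovariance : ProjectiveCovariance := by
  sorry

/-- STUB 4 (size XL, the HARDEST): classical well-posedness of the symmetric-hyperbolic hard-sphere system
at small packing (`Z` analytic near `0`: route support `HsEosLowDensity`, stmt-0768) and the dual-clock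
energy estimate — `H^m` energies with weights a power of the conformal factor, closed while
`A σ³ Λ^K ≤ 1/2`, i.e. down to depth `T* − T = T*(2Aσ³)^{1/K} =: Bσ^{3/K}`. -/
theorem stub_conformalClockShadowing : ConformalClockShadowing := by
  sorry

/-! ## Composition (sorry-free) -/

/-- The `t = 0` tie only reads the time-`0` slices of the fields: transport along equal data. -/
theorem tendstoHydroFieldsAt_zero_of_data_eq {ε : ℕ → ℝ}
    {P : (N : ℕ) → Measure (Literature.Analysis.FluidPDE.Config (N + 1) (Fin 3) T3)}
    {Φ : (N : ℕ) → Literature.Analysis.FluidPDE.HardSphereFlow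
        (Literature.Analysis.FluidPDE.Torus.geometry (Fin 3)) (ε N) (N + 1)}
    {ρ θ : ℝ → T3 → ℝ} {u : ℝ → T3 → V3} {r ϑ : T3 → ℝ} {v : T3 → V3}
    (hρ : ρ 0 = r) (hu : u 0 = v) (hθ : θ 0 = ϑ)
    (h : TendstoHydroFieldsAt P Φ (fun _ => r) (fun _ => v) (fun _ => ϑ) 0) :
    TendstoHydroFieldsAt P Φ ρ u θ 0 := by
  subst hρ hu hθ
  exact h

/-- **Composition of the line** (the exponent bookkeeping of the conformal clock, proved): reference in
conformal normal form + tied smooth data family + clock identity + shadowing to conformal depth `σ^e`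
give `PolynomialCompression` with `κ = eβ/2` — read the core density `c (T*−t)^{−β}` at
`T* − t = 2(T* − T) ≤ 2Bσ^e`, where the σ-density is within a factor `2` of the reference. -/
theorem polynomialCompression_of_parts (h₁ : ClockedIdealImplosion) (h₂ : SmoothStatics)
    (h₃ : ProjectiveCovariance) (h₄ : ConformalClockShadowing) :
    ∃ κ : ℝ, 0 < κ ∧ ∃ (a₀ θ₀ : T3 → ℝ) (u₀ : T3 → V3), Continuous a₀ ∧ Continuous θ₀ ∧ Continuous u₀ ∧
      (∀ x, 0 < a₀ x) ∧ (∀ x, 0 < θ₀ x) ∧ ∀ σ₀ : ℝ, 0 < σ₀ → ∃ σ : ℝ, 0 < σ ∧ σ < σ₀ ∧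
        ∃ (T : ℝ) (ρ θ : ℝ → T3 → ℝ) (u : ℝ → T3 → V3), IsHardSphereEulerSolution σ T ρ u θ ∧
          (∀ Φ : (N : ℕ) → Literature.Analysis.FluidPDE.HardSphereFlow
              (Literature.Analysis.FluidPDE.Torus.geometry (Fin 3)) (hsDiameter σ N) (N + 1),
            TendstoHydroFieldsAt (fun N => localGibbsLaw σ a₀ u₀ θ₀ N (Φ N)) Φ ρ u θ 0) ∧
          ∃ t ∈ Set.Ico 0 T, ∃ x, σ ^ (-κ) ≤ ρ t x := by
  obtain ⟨a₀, θ₀, u₀, ha, hθ, hu, ha0, hθ0, Ts, β, c, ρ₁, θ₁, u₁, hNF, hρ10, hu10, hθ10⟩ := h₁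
  have hNF' := hNF
  obtain ⟨hTs, hβ, hc, hsol, hcore, -, -, -⟩ := hNF'
  -- the normalised activity is the (smooth) time-0 slice of the reference density
  have hb : (fun x => a₀ x / ∫ y, a₀ y) = ρ₁ 0 := funext fun x => (hρ10 x).symm
  have hbs : Literature.Analysis.FunctionSpaces.Torus.IsSmooth (fun x => a₀ x / ∫ y, a₀ y) := by
    rw [hb]; exact hsol.smooth_density.isSmooth_slice ⟨le_rfl, hTs⟩
  obtain ⟨σ₁, hσ₁, ρ₀, hrate, hfam⟩ := h₂ a₀ θ₀ u₀ ha hθ hu ha0 hθ0 hbs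
  rw [hb] at hrate
  obtain ⟨K, A, B, e, σ₂, he, hB, hσ₂, hσ₂₁, hsh⟩ :=
    h₄ h₃ Ts β c ρ₁ θ₁ u₁ hNF σ₁ ρ₀ hσ₁ hrate (fun σ hσ hσ' => ⟨(hfam σ hσ hσ').1, (hfam σ hσ hσ').2.1⟩)
  have hBne : B ≠ 0 := hB.ne'
  -- the compression constant and the exponent
  set C₀ : ℝ := c / 2 * (2 * B) ^ (-β) with hC₀
  have hC₀pos : 0 < C₀ := by positivity
  have hκne : e * β / 2 ≠ 0 := by positivity
  refine ⟨e * β / 2, by positivity, a₀, θ₀, u₀, ha, hθ, hu, ha0, hθ0, fun σ₀ hσ₀ => ?_⟩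
  -- the choice of σ: below σ₀, σ₂ and the two thresholds (depth ≤ T*/2, compression ≥ σ^{-κ})
  set s₁ : ℝ := (Ts / (2 * B)) ^ e⁻¹ with hs₁
  set s₂ : ℝ := C₀ ^ (e * β / 2)⁻¹ with hs₂
  have hs₁pos : 0 < s₁ := Real.rpow_pos_of_pos (by positivity) _
  have hs₂pos : 0 < s₂ := Real.rpow_pos_of_pos hC₀pos _
  set σ : ℝ := min (min (σ₀ / 2) (σ₂ / 2)) (min s₁ s₂) with hσdef
  have hσpos : 0 < σ := lt_min (lt_min (half_pos hσ₀) (half_pos hσ₂)) (lt_min hs₁pos hs₂pos)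
  have hσσ₀ : σ < σ₀ :=
    lt_of_le_of_lt ((min_le_left _ _).trans (min_le_left _ _)) (half_lt_self hσ₀)
  have hσσ₂ : σ < σ₂ :=
    lt_of_le_of_lt ((min_le_left _ _).trans (min_le_right _ _)) (half_lt_self hσ₂)
  have hσs₁ : σ ≤ s₁ := (min_le_right _ _).trans (min_le_left _ _)
  have hσs₂ : σ ≤ s₂ := (min_le_right _ _).trans (min_le_right _ _)
  have hσe : σ ^ e ≤ Ts / (2 * B) := by
    calc σ ^ e ≤ s₁ ^ e := Real.rpow_le_rpow hσpos.le hσs₁ he.le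
      _ = Ts / (2 * B) := by rw [hs₁]; exact Real.rpow_inv_rpow (by positivity) he.ne'
  have hσκ : σ ^ (e * β / 2) ≤ C₀ := by
    calc σ ^ (e * β / 2) ≤ s₂ ^ (e * β / 2) := Real.rpow_le_rpow hσpos.le hσs₂ (by positivity)
      _ = C₀ := by rw [hs₂]; exact Real.rpow_inv_rpow hC₀pos.le hκne
  -- the shadowing solution at this σ
  obtain ⟨T, ρ, θ, u, hT0, hTTs, hdepth, hsolσ, hρ0, hu0, hθ0', htrack⟩ := hsh σ hσpos hσσ₂
  refine ⟨σ, hσpos, hσσ₀, T, ρ, θ, u, hsolσ, ?_, ?_⟩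
  · -- the t = 0 tie (admissibility): LLN of the statics stub, transported along the pinned data
    intro Φ
    have hσσ₁ : σ < σ₁ := hσσ₂.trans_le hσ₂₁
    exact tendstoHydroFieldsAt_zero_of_data_eq hρ0 (hu0.trans hu10) (hθ0'.trans hθ10)
      ((hfam σ hσpos hσσ₁).2.2 Φ).2
  · -- compression: read the core at conformal factor T* - t = 2 (T* - T)
    set D : ℝ := Ts - T with hD
    have hDpos : 0 < D := by rw [hD]; linarith
    have h2D : 2 * D ≤ Ts := by
      have h1 : B * σ ^ e ≤ B * (Ts / (2 * B)) := mul_le_mul_of_nonneg_left hσe hB.le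
      have h2 : B * (Ts / (2 * B)) = Ts / 2 := by field_simp
      linarith
    set t : ℝ := Ts - 2 * D with ht
    have ht0 : 0 ≤ t := by rw [ht]; linarith
    have htT : t < T := by rw [ht, hD]; linarith
    have htTs : t < Ts := htT.trans hTTs
    have hTst : Ts - t = 2 * D := by rw [ht]; ring
    obtain ⟨x, hx⟩ := hcore t ⟨ht0, htTs⟩
    have h2 := (htrack t ⟨ht0, htT⟩ x).2
    refine ⟨t, ⟨ht0, htT⟩, x, ?_⟩
    rw [hTst] at hx
    have step1 : (2 * (B * σ ^ e)) ^ (-β) ≤ (2 * D) ^ (-β) :=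
      Real.rpow_le_rpow_of_nonpos (by positivity) (by linarith) (by linarith [hβ.le])
    have step2 : (2 * (B * σ ^ e)) ^ (-β) = (2 * B) ^ (-β) * σ ^ (-(e * β)) := by
      rw [show (2 * (B * σ ^ e)) = (2 * B) * σ ^ e by ring,
        Real.mul_rpow (by positivity) (by positivity), ← Real.rpow_mul hσpos.le,
        show e * -β = -(e * β) by ring]
    have step3 : σ ^ (-(e * β / 2)) = σ ^ (e * β / 2) * σ ^ (-(e * β)) := by
      rw [← Real.rpow_add hσpos, show e * β / 2 + -(e * β) = -(e * β / 2) by ring]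
    have hσneg : 0 < σ ^ (-(e * β)) := Real.rpow_pos_of_pos hσpos _
    have hx' : c / 2 * (2 * D) ^ (-β) ≤ ρ₁ t x / 2 := by
      have : c / 2 * (2 * D) ^ (-β) = (c * (2 * D) ^ (-β)) / 2 := by ring
      rw [this]; linarith
    calc σ ^ (-(e * β / 2)) = σ ^ (e * β / 2) * σ ^ (-(e * β)) := step3
      _ ≤ C₀ * σ ^ (-(e * β)) := mul_le_mul_of_nonneg_right hσκ hσneg.le
      _ = c / 2 * ((2 * B) ^ (-β) * σ ^ (-(e * β))) := by rw [hC₀]; ring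
      _ = c / 2 * (2 * (B * σ ^ e)) ^ (-β) := by rw [step2]
      _ ≤ c / 2 * (2 * D) ^ (-β) := mul_le_mul_of_nonneg_left step1 (by positivity)
      _ ≤ ρ₁ t x / 2 := hx'
      _ ≤ ρ t x := by linarith

/-- **The skeleton concludes the crux BY NAME.** `PolynomialCompression` (route `ImplosionDichotomy`,
stmt-AtomisticToContinuum-12587) from the four registered stubs. -/
theorem PolynomialCompression_of : PolynomialCompression :=
  polynomialCompression_of_parts stub_clockedIdealImplosion stub_smoothStatics
    stub_projectiveCovariance stub_conformalClockShadowing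

end Summit.AtomisticToContinuum.HydrodynamicLimit.Cruxes.PolynomialCompression.ConformalClock
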